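import Summits.QuantumFields.YangMills.Theorems.InfiniteVolumeContinuumIVEuclideanInvarianceGerm
import Summits.QuantumFields.YangMills.Theorems.InfiniteVolumeTorusSchemeAlong
import Summits.QuantumFields.YangMills.Theorems.InfiniteVolumeContinuumIVEuclideanInvarianceDensity
import Summits.QuantumFields.YangMills.Theorems.InfiniteVolumeContinuumIVEuclideanInvarianceSigned
import Summits.QuantumFields.YangMills.Theorems.InfiniteVolumeContinuumIVEuclideanInvarianceSymmetric
import Summits.QuantumFields.YangMills.Theorems.BalabanLadderROTClassDefs
import Summits.QuantumFields.YangMills.Theorems.LangevinControlUVOSLegsAtWeakCouplingCStubLocality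
import Summits.QuantumFields.YangMills.Theorems.LangevinControlUVOSLegsAtWeakCouplingCSketchGermRot
import HarnessLib

/-!
# Route `InfiniteVolumeContinuum` (target stmt-QuantumFields-19927): Euclidean invariance of the infinite-volume-first
# continuum data ON A TORUS CLASS — the E1 support re-run against the class-local rotation leg `LatticeRotWardOn`

Seat `ym-infvol-p1` (R136 (i); the E1 support `IVEuclideanInvariance`, stmt-QuantumFields-19933, is CLOSED by
`IVEuclideanInvariance_proof`).  HONEST FRAMING: existence half only, conditional on Track A's `BalabanLadder.UV`;
the ceilings `MomentBounds6 G r a` and the class-local rotation Ward identities `Theorems.ROT.LatticeRotWardOn G r a 𝒮`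
are HYPOTHESES (the latter is the conclusion shape of the spine's crux `ROT` rev 2′, which is itself guarded by the
infrared leg `GapInUnits`); nothing about Yang–Mills is asserted unconditionally; not a gap, not Clay.

WHY THIS FILE (route owner ym-beyond-p2 g21, `R85-BATCH-EDITS.md` rev 3e §5b, 2026-08-26T20:50Z).  The planned restate
of the spine's rotation crux `BalabanLadder.ROT` to rev 2′,
`… → LowerBounds G r a → MomentBounds6 G r a → GapInUnits G r a → ∃ S, UnboundedClass S ∧ LatticeRotWardOn G r a S`,
replaces the all-schemes Ward leg `LatticeRotWard G r a` consumed by `IVEuclideanInvariance` by Ward identities along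
the admissible schemes whose torus HALF-SIDES lie in an unbounded class `S` only (King-fitted tori).  This file supplies
the E1 support in that currency, Theses-free and binder-agnostic, so that whichever class-local re-typing of the
route's DATA clause the planner files can be closed by `exact`:

* (step 6′, `Theorems/InfiniteVolumeTorusSchemeAlong.lean`) `exists_torusSides_approximating_along` — seat p2's
  (A)↔(B) junction with the states' DEFINING odd-torus sequences `N k` as INPUT: the approximating half-sides `L k` are
  members of `N k`, hence of any class containing the `N k j`.
* §2 `germ_of_latticeRotWardOn_of_torusApprox` — this seat's reduction `germ_of_latticeRotWard_of_torusApprox` with the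
  Ward leg on a class `𝒮` and torus half-sides in `𝒮`.
* §3 `germ_of_latticeRotWardOn` — stub W3 on a class: det-1 planar germ invariance of the continuum data of states
  `μ k` that are infinite-volume limits ALONG odd tori `2·N k j + 1` with `N k j ∈ 𝒮`.
* §4 `isEuclideanInvariant_of_latticeRotWardOn` — the E1 support on a class: with W0 (`isSymmetric_of_ivData`), W1
  (`stub_ivSigned`, seat p3), W2 (`stub_ivDensity`) unchanged (an infinite-volume limit along `𝒮`-tori is an odd-torus
  limit point) and §3, the spine's `Sketch.stub_locality` + `Sketch.isEuclideanInvariant_of_planarRot` give full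
  Euclidean invariance on `⁰𝒮`.  With `𝒮 = univ` this is the closed item again (`LatticeRotWardOn … univ` is
  `LatticeRotWard` restricted to nothing).

References: C. King, CMP 103 (1986) 323–349, Thm 2.4; K. Osterwalder, R. Schrader, CMP 31 (1973), CMP 42 (1975);
J. Glimm, A. Jaffe, Quantum Physics (1987) §6.1; S. Chatterjee, arXiv:1803.01950 §2.
-/

set_option autoImplicit false

noncomputable section

open MeasureTheory Filter Topology
open scoped BigOperators SchwartzMap
open Literature.MathematicalPhysics.QuantumFieldTheory hiding ZdEdge
open Literature.MathematicalPhysics.QuantumLattice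
open Literature.MathematicalPhysics.AQFT
open Literature.Probability.LatticeModels (Site)
open Summit.QuantumFields.YangMills.Cruxes.OSLegsFromFemtoAndGap.DlrCollarTransfer
open Summit.QuantumFields.YangMills.Cruxes.OSLegsAtWeakCouplingC.Sketch
  (IsPlanar01 OffDiagDensity Invariant GermInvariant IsSignedPerm Separated SmallDiam tsupport_rotDeriv_subset
    stub_locality isEuclideanInvariant_of_planarRot)
open Summit.QuantumFields.YangMills.Cruxes.OSLegsAtWeakCouplingC.Sketch.GermWard
  (germInvariant_planeRot_of_ward isOffDiagonal_of_tsupport_subset_separated)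
open Summit.QuantumFields.YangMills.Theorems.OSLegsFromFemtoAndGap
  (latticeDist latticeDistStr latticeDist_dens_eq_sum_latticeDistStr)
open Summit.QuantumFields.YangMills.Theorems.NPointIsotropy.ComplexRotationBandlimit.Mopup (exists_eq_planeRot)
open Summit.QuantumFields.YangMills.Theorems.ROT (UnboundedClass LatticeRotWardOn)

namespace Summit.QuantumFields.YangMills.Theorems.InfiniteVolume.E1

variable {G : Type} [Group G] [TopologicalSpace G] [IsTopologicalGroup G] [CompactSpace G]
  [MeasurableSpace G] [BorelSpace G]

/-! ## §2 The germ reduction with the Ward leg on a class -/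

/-- **W3 reduced to the torus approximation, class-local Ward leg.**  Couplings `β_k → ∞`, a positive unit `a → 0`,
torus half-sides `L_k` IN THE CLASS `𝒮` with `14 ≤ L_k` and `a(β_k)⁻² ≤ L_k`, a one-field family `S₁` with `S₁ 1 = 0`
and bounded densities off the diagonal which is the limit on `⁰𝒮` (arities `≥ 2`) of the spine's torus density
functionals along `(β_k, L_k, a(β_k))`: then `LatticeRotWardOn G r a 𝒮` gives `r₁ > 0` such that every det-1
isometry of the `(x₀,x₁)`-plane fixes `S₁` on off-diagonal tests of diameter `< r₁`. [folklore] -/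
theorem germ_of_latticeRotWardOn_of_torusApprox (r : LatticeRep G) (a : ℝ → ℝ) (𝒮 : Set ℕ) (β : ℕ → ℝ)
    (L : ℕ → ℕ) (S₁ : SchwingerFamily (EuclideanSpace ℝ (Fin 4))) (hapos : ∀ b, 0 < a b)
    (ha0 : Tendsto a atTop (𝓝 0)) (hROT : LatticeRotWardOn G r a 𝒮) (hβ : Tendsto β atTop atTop)
    (hL𝒮 : ∀ k, L k ∈ 𝒮) (hL : ∀ k, 14 ≤ L k ∧ (a (β k))⁻¹ * (a (β k))⁻¹ ≤ L k)
    (h1 : ∀ F : 𝓢((Fin 1 → EuclideanSpace ℝ (Fin 4)), ℂ), S₁ 1 F = 0) (hdens : OffDiagDensity S₁)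
    (hconvT : ∀ n : ℕ, 2 ≤ n → ∀ F : 𝓢((Fin n → EuclideanSpace ℝ (Fin 4)), ℂ), IsOffDiagonal F →
      Tendsto (fun k => latticeDist r.ρ (β k) (L k) (a (β k)) r.curvature.F
        (wilsonTorusMean r.ρ (β k) (L k) r.curvature.F) n F) atTop (𝓝 (S₁ n F))) :
    ∃ r₁ : ℝ, 0 < r₁ ∧ ∀ R : EuclideanSpace ℝ (Fin 4) ≃ₗᵢ[ℝ] EuclideanSpace ℝ (Fin 4),
      LinearMap.det (R.toLinearEquiv : EuclideanSpace ℝ (Fin 4) →ₗ[ℝ] EuclideanSpace ℝ (Fin 4)) = 1 → IsPlanar01 R →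
        GermInvariant S₁ R r₁ := by
  -- a tail of the sequence on which the scheme ranges hold
  obtain ⟨k₀, hk₀⟩ : ∃ k₀ : ℕ, ∀ k, k₀ ≤ k → 0 ≤ β k ∧ a (β k) ≤ 1 / 24 := by
    have h1' : ∀ᶠ k in atTop, 0 ≤ β k := hβ.eventually_ge_atTop 0
    have h2' : ∀ᶠ k in atTop, a (β k) ≤ 1 / 24 :=
      (ha0.comp hβ).eventually (ge_mem_nhds (by norm_num : (0 : ℝ) < 1 / 24))
    obtain ⟨k₀, hk₀⟩ := (h1'.and h2').exists_forall_of_atTop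
    exact ⟨k₀, hk₀⟩
  -- the tail as an admissible species scheme in units `a`, with tori in the class
  have htendL : Tendsto (fun k => a (β (k + k₀)) * (L (k + k₀) : ℕ)) atTop atTop := by
    have hinv : Tendsto (fun k => (a (β (k + k₀)))⁻¹) atTop atTop :=
      tendsto_inv_nhdsGT_zero.comp (tendsto_nhdsWithin_iff.2
        ⟨((ha0.comp hβ).comp (tendsto_add_atTop_nat k₀)), Eventually.of_forall fun k => hapos _⟩)
    refine tendsto_atTop_mono (fun k => ?_) hinv
    have ha : 0 < a (β (k + k₀)) := hapos _
    have hLk := (hL (k + k₀)).2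
    calc (a (β (k + k₀)))⁻¹ = a (β (k + k₀)) * ((a (β (k + k₀)))⁻¹ * (a (β (k + k₀)))⁻¹) := by
          field_simp
      _ ≤ a (β (k + k₀)) * (L (k + k₀) : ℕ) := mul_le_mul_of_nonneg_left hLk ha.le
  let sch : SpeciesScheme (YMSpecies G) :=
    { a := fun k => a (β (k + k₀))
      a_pos := fun k => hapos _
      tendsto_a := (ha0.comp hβ).comp (tendsto_add_atTop_nat k₀)
      β := fun k => β (k + k₀)
      L := fun k => L (k + k₀)
      tendsto_L := htendL
      c := fun _ _ => 0
      m := fun _ _ => 0 }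
  have hranges : ∀ k, 0 ≤ sch.β k ∧ sch.a k ≤ 1 / 24 ∧ 14 ≤ sch.L k ∧ (sch.a k)⁻¹ * (sch.a k)⁻¹ ≤ sch.L k := fun k =>
    ⟨(hk₀ (k + k₀) (Nat.le_add_left _ _)).1, (hk₀ (k + k₀) (Nat.le_add_left _ _)).2, (hL (k + k₀)).1, (hL (k + k₀)).2⟩
  obtain ⟨r₀, hr₀, hW⟩ :=
    hROT sch (fun k => hL𝒮 (k + k₀)) (fun k => rfl) (hβ.comp (tendsto_add_atTop_nat k₀)) hranges
  -- the Ward identity on the germ, by uniqueness of limits along the tail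
  have hW' : ∀ (n : ℕ), 2 ≤ n → ∀ (F D : 𝓢((Fin n → EuclideanSpace ℝ (Fin 4)), ℂ)), IsOffDiagonal F →
      HasCompactSupport (F : (Fin n → EuclideanSpace ℝ (Fin 4)) → ℂ) →
      (∃ δ : ℝ, 0 < δ ∧ tsupport (F : (Fin n → EuclideanSpace ℝ (Fin 4)) → ℂ) ⊆ Separated n δ) →
      tsupport (F : (Fin n → EuclideanSpace ℝ (Fin 4)) → ℂ) ⊆ SmallDiam n r₀ →
      (∀ x, D x = fderiv ℝ (F : (Fin n → EuclideanSpace ℝ (Fin 4)) → ℂ) x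
        (fun k => (x k 0) • (EuclideanSpace.single 1 1 : EuclideanSpace ℝ (Fin 4)) -
          (x k 1) • (EuclideanSpace.single 0 1 : EuclideanSpace ℝ (Fin 4)))) →
      S₁ n D = 0 := by
    intro n hn F D hF hFc hδ hFr hD
    obtain ⟨δ, hδ, hFδ⟩ := hδ
    have hDoff : IsOffDiagonal D :=
      isOffDiagonal_of_tsupport_subset_separated hδ ((tsupport_rotDeriv_subset F D hD).trans hFδ)
    have hlim : Tendsto (fun k => latticeDist r.ρ (sch.β k) (sch.L k) (sch.a k) r.curvature.F
        (wilsonTorusMean r.ρ (sch.β k) (sch.L k) r.curvature.F) n D) atTop (𝓝 (S₁ n D)) :=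
      (hconvT n hn D hDoff).comp (tendsto_add_atTop_nat k₀)
    exact tendsto_nhds_unique hlim (hW n hn F D hF hFc ⟨δ, hδ, hFδ⟩ hFr hD)
  refine ⟨r₀, hr₀, fun R hdet hR => ?_⟩
  obtain ⟨φ, rfl⟩ := exists_eq_planeRot R hdet hR.1 hR.2
  exact germInvariant_planeRot_of_ward S₁ hdens h1 hW' φ

/-! ## §3 Stub W3 on a class -/

/-- **W3 on a class — det-1 planar germ invariance from `LatticeRotWardOn G r a 𝒮`** for continuum data of states
`μ k` that are infinite-volume limits along odd tori `2·N k j + 1` with every `N k j ∈ 𝒮` (so every `μ k` is in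
particular an odd-torus limit point), in a positive unit `a → 0` carrying `MomentBounds6 G r a`, with the conventions
`S₁ 1 = 0`, `S₁ n = Σ_q T n q`, the centre-smeared convergence clause, and bounded densities off the diagonal: the
junction of §1 keeps the approximating tori inside `𝒮`, and §2 applies. [folklore] -/
theorem germ_of_latticeRotWardOn (r : LatticeRep G) (a : ℝ → ℝ) (𝒮 : Set ℕ) (β : ℕ → ℝ)
    (μ : ℕ → Measure (LGConfig 4 G)) (N : ℕ → ℕ → ℕ)
    (S₁ : SchwingerFamily (EuclideanSpace ℝ (Fin 4)))
    (T : (n : ℕ) → (Fin n → Fin 4 × Fin 4) → (𝓢((Fin n → EuclideanSpace ℝ (Fin 4)), ℂ) →L[ℂ] ℂ))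
    (hapos : ∀ b, 0 < a b) (ha0 : Tendsto a atTop (𝓝 0)) (hMB : MomentBounds6 G r a) (hROT : LatticeRotWardOn G r a 𝒮)
    (hβ : Tendsto β atTop atTop) (hN : ∀ k, StrictMono (N k)) (hN𝒮 : ∀ k j, N k j ∈ 𝒮)
    (hμ : ∀ k, IsInfiniteVolumeLimitAlong (d := 4) r.ρ (β k) (fun j => 2 * N k j) (μ k))
    (h1 : ∀ F : 𝓢((Fin 1 → EuclideanSpace ℝ (Fin 4)), ℂ), S₁ 1 F = 0)
    (hS : ∀ n : ℕ, 2 ≤ n → ∀ F : 𝓢((Fin n → EuclideanSpace ℝ (Fin 4)), ℂ),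
      S₁ n F = ∑ q ∈ Fintype.piFinset (fun _ : Fin n => Finset.univ.filter fun p : Fin 4 × Fin 4 => p.1 < p.2), T n q F)
    (hT : ∀ n : ℕ, 2 ≤ n → ∀ q : Fin n → Fin 4 × Fin 4, (∀ i, (q i).1 < (q i).2) →
      ∀ F : 𝓢((Fin n → EuclideanSpace ℝ (Fin 4)), ℂ), IsOffDiagonal F →
        Tendsto (fun k => ∑' x : Fin n → (Fin 4 → ℤ), ((stateMomentStr G r (μ k) n q x : ℝ) : ℂ) *
          F (fun l => a (β k) • siteToE (x l) + (a (β k) / 2) •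
            (EuclideanSpace.single (q l).1 (1 : ℝ) + EuclideanSpace.single (q l).2 (1 : ℝ)))) atTop (𝓝 (T n q F)))
    (hdens : OffDiagDensity S₁) :
    ∃ r₁ : ℝ, 0 < r₁ ∧ ∀ R : EuclideanSpace ℝ (Fin 4) ≃ₗᵢ[ℝ] EuclideanSpace ℝ (Fin 4),
      LinearMap.det (R.toLinearEquiv : EuclideanSpace ℝ (Fin 4) →ₗ[ℝ] EuclideanSpace ℝ (Fin 4)) = 1 → IsPlanar01 R →
        GermInvariant S₁ R r₁ := by
  classical
  have hμodd : ∀ k, μ k ∈ oddTorusLimitPoints r (β k) := fun k => ⟨N k, hN k, hμ k⟩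
  -- thresholds of the junction, and a tail of the data inside them
  obtain ⟨β₀, ℓ₀, hℓ₀, HJ⟩ := exists_torusSides_approximating_along r hMB
  obtain ⟨k₁, hk₁⟩ : ∃ k₁ : ℕ, ∀ k, k₁ ≤ k → β₀ ≤ β k ∧ a (β k) ≤ 1 / 24 ∧ a (β k) ≤ ℓ₀ := by
    have e1 : ∀ᶠ k in atTop, β₀ ≤ β k := hβ.eventually_ge_atTop β₀
    have e2 : ∀ᶠ k in atTop, a (β k) ≤ 1 / 24 :=
      (ha0.comp hβ).eventually (ge_mem_nhds (by norm_num : (0 : ℝ) < 1 / 24))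
    have e3 : ∀ᶠ k in atTop, a (β k) ≤ ℓ₀ := (ha0.comp hβ).eventually (ge_mem_nhds hℓ₀)
    obtain ⟨k₁, hk₁⟩ := (e1.and (e2.and e3)).exists_forall_of_atTop
    exact ⟨k₁, hk₁⟩
  set β' : ℕ → ℝ := fun k => β (k + k₁) with hβ'def
  set μ' : ℕ → Measure (LGConfig 4 G) := fun k => μ (k + k₁) with hμ'def
  have hβ' : Tendsto β' atTop atTop := hβ.comp (tendsto_add_atTop_nat k₁)
  have hμ' : ∀ k, μ' k ∈ oddTorusLimitPoints r (β' k) := fun k => hμodd _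
  have htail : ∀ k, β₀ ≤ β' k ∧ a (β' k) ≤ 1 / 24 ∧ a (β' k) ≤ ℓ₀ := fun k => hk₁ (k + k₁) (Nat.le_add_left _ _)
  obtain ⟨L, -, hL, hLN, hJ⟩ := HJ β' (fun k => (htail k).1) (fun k => hapos _) (fun k => (htail k).2.1)
    (fun k => (htail k).2.2) μ' (fun k => N (k + k₁)) (fun k => hN _) (fun k => hμ _) (fun _ => 0)
  have hL𝒮 : ∀ k, L k ∈ 𝒮 := fun k => by
    obtain ⟨j, hj⟩ := hLN k
    rw [← hj]
    exact hN𝒮 _ _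
  -- the torus density functionals along the tail converge to `S₁ n F` on `⁰𝒮`
  have hconvT : ∀ n : ℕ, 2 ≤ n → ∀ F : 𝓢((Fin n → EuclideanSpace ℝ (Fin 4)), ℂ), IsOffDiagonal F →
      Tendsto (fun k => latticeDist r.ρ (β' k) (L k) (a (β' k)) r.curvature.F
        (wilsonTorusMean r.ρ (β' k) (L k) r.curvature.F) n F) atTop (𝓝 (S₁ n F)) := by
    intro n hn F hF
    rw [hS n hn F]
    have hrw : (fun k => latticeDist r.ρ (β' k) (L k) (a (β' k)) r.curvature.F
        (wilsonTorusMean r.ρ (β' k) (L k) r.curvature.F) n F) = fun k =>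
        ∑ q ∈ Fintype.piFinset (fun _ : Fin n => Finset.univ.filter fun p : Fin 4 × Fin 4 => p.1 < p.2),
          latticeDistStr r.ρ (β' k) (L k) (a (β' k)) (fun i U => plaquetteObs r.ρ 0 (q i).1 (q i).2 U)
            (fun i => wilsonTorusMean r.ρ (β' k) (L k) (fun U => plaquetteObs r.ρ 0 (q i).1 (q i).2 U)) F :=
      funext fun k => latticeDist_dens_eq_sum_latticeDistStr r _ _ _ n F
    rw [hrw]
    refine tendsto_finsetSum _ fun q hq => ?_
    have hqv : ∀ i, (q i).1 < (q i).2 := fun i => by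
      rw [Fintype.mem_piFinset] at hq
      exact (Finset.mem_filter.1 (hq i)).2
    -- base-point series → `T n q F` (seat p2's centre ↔ base), torus strings asymptotic to it (the junction)
    have hbase : Tendsto (fun k => ∑' x : Fin n → (Fin 4 → ℤ), ((stateMomentStr G r (μ' k) n q x : ℝ) : ℂ) *
        F (fun l => a (β' k) • siteToE (x l))) atTop (𝓝 (T n q F)) :=
      tendsto_base_of_tendsto_centre r hapos ha0 hMB β' hβ' μ' hμ' hn q hqv F hF
        ((hT n hn q hqv F hF).comp (tendsto_add_atTop_nat k₁))
    have hdiff := hJ n hn q hqv F hF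
    have hsum := hdiff.add hbase
    rw [zero_add] at hsum
    refine hsum.congr fun k => ?_
    simp only [stateMomentStr, hμ'def, hβ'def, sub_add_cancel]
  exact germ_of_latticeRotWardOn_of_torusApprox r a 𝒮 β' L S₁ hapos ha0 hROT hβ' hL𝒮 hL h1 hdens hconvT

/-! ## §4 The E1 support on a class -/

/-- **E1 on a class.**  For every compact `G`, `r`, positive unit `a → 0` with `MomentBounds6 G r a` and the class-local
rotation Ward identities `LatticeRotWardOn G r a 𝒮`, every tuple `(β, μ, S₁, T)` with `β_k → ∞`, states `μ k` that are
infinite-volume limits along odd tori of half-sides `N k j ∈ 𝒮`, the conventions (`S₁ 0 = ev`, `S₁ 1 = 0`,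
`S₁ n = Σ_q T n q`), the centre-smeared DATA convergence, E0′ linear growth, translation invariance on `⁰𝒮` and
`RPPos`, has `S₁.toLabelled.IsEuclideanInvariant`: W0–W2 (E3, signed permutations, bounded densities — unchanged,
each `μ k` being an odd-torus limit point), W3 on the class (§3), the spine's locality theorem `Sketch.stub_locality`
and the Givens generation `Sketch.isEuclideanInvariant_of_planarRot`. [folklore] -/
theorem isEuclideanInvariant_of_latticeRotWardOn (r : LatticeRep G) (a : ℝ → ℝ) (𝒮 : Set ℕ) (β : ℕ → ℝ)
    (μ : ℕ → Measure (LGConfig 4 G)) (N : ℕ → ℕ → ℕ)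
    (S₁ : SchwingerFamily (EuclideanSpace ℝ (Fin 4)))
    (T : (n : ℕ) → (Fin n → Fin 4 × Fin 4) → (𝓢((Fin n → EuclideanSpace ℝ (Fin 4)), ℂ) →L[ℂ] ℂ))
    (hapos : ∀ b, 0 < a b) (ha0 : Tendsto a atTop (𝓝 0)) (hMB : MomentBounds6 G r a) (hROT : LatticeRotWardOn G r a 𝒮)
    (hβ : Tendsto β atTop atTop) (hN : ∀ k, StrictMono (N k)) (hN𝒮 : ∀ k j, N k j ∈ 𝒮)
    (hμ : ∀ k, IsInfiniteVolumeLimitAlong (d := 4) r.ρ (β k) (fun j => 2 * N k j) (μ k))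
    (h0 : ∀ F : 𝓢((Fin 0 → EuclideanSpace ℝ (Fin 4)), ℂ), S₁ 0 F = F default)
    (h1 : ∀ F : 𝓢((Fin 1 → EuclideanSpace ℝ (Fin 4)), ℂ), S₁ 1 F = 0)
    (hS : ∀ n : ℕ, 2 ≤ n → ∀ F : 𝓢((Fin n → EuclideanSpace ℝ (Fin 4)), ℂ),
      S₁ n F = ∑ q ∈ Fintype.piFinset (fun _ : Fin n => Finset.univ.filter fun p : Fin 4 × Fin 4 => p.1 < p.2), T n q F)
    (hT : ∀ n : ℕ, 2 ≤ n → ∀ q : Fin n → Fin 4 × Fin 4, (∀ i, (q i).1 < (q i).2) →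
      ∀ F : 𝓢((Fin n → EuclideanSpace ℝ (Fin 4)), ℂ), IsOffDiagonal F →
        Tendsto (fun k => ∑' x : Fin n → (Fin 4 → ℤ), ((stateMomentStr G r (μ k) n q x : ℝ) : ℂ) *
          F (fun l => a (β k) • siteToE (x l) + (a (β k) / 2) •
            (EuclideanSpace.single (q l).1 (1 : ℝ) + EuclideanSpace.single (q l).2 (1 : ℝ)))) atTop (𝓝 (T n q F)))
    (hLG : S₁.toLabelled.HasLinearGrowth)
    (htrans : ∀ (n : ℕ) (t : EuclideanSpace ℝ (Fin 4)) (F : 𝓢((Fin n → EuclideanSpace ℝ (Fin 4)), ℂ)),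
      IsOffDiagonal F → S₁ n (translateMulti t F) = S₁ n F)
    (hRP : RPPos S₁) :
    S₁.toLabelled.IsEuclideanInvariant := by
  have hμodd : ∀ k, μ k ∈ oddTorusLimitPoints r (β k) := fun k => ⟨N k, hN k, hμ k⟩
  have hE3 : S₁.toLabelled.IsSymmetric := isSymmetric_of_ivData r a β μ S₁ T h0 h1 hS hT
  have hsigned : ∀ R : EuclideanSpace ℝ (Fin 4) ≃ₗᵢ[ℝ] EuclideanSpace ℝ (Fin 4), IsSignedPerm R → Invariant S₁ R :=
    stub_ivSigned r a β μ S₁ T hapos hμodd h0 h1 hS hT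
  have hdens : OffDiagDensity S₁ := stub_ivDensity r a β μ S₁ T hapos ha0 hMB hβ hμodd h0 h1 hS hT
  obtain ⟨r₁, hr₁, hgerm⟩ :=
    germ_of_latticeRotWardOn r a 𝒮 β μ N S₁ T hapos ha0 hMB hROT hβ hN hN𝒮 hμ h1 hS hT hdens
  have hplanar : ∀ R : EuclideanSpace ℝ (Fin 4) ≃ₗᵢ[ℝ] EuclideanSpace ℝ (Fin 4),
      LinearMap.det (R.toLinearEquiv : EuclideanSpace ℝ (Fin 4) →ₗ[ℝ] EuclideanSpace ℝ (Fin 4)) = 1 → IsPlanar01 R →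
      Invariant S₁ R := fun R hdet hR =>
    stub_locality S₁ h0 htrans hE3 hLG hRP hsigned hdens R hR r₁ hr₁ (hgerm R hdet hR)
  exact isEuclideanInvariant_of_planarRot S₁ htrans hsigned hplanar

/-- **The all-schemes item shape recovered** (`𝒮 = univ`): the spine's rev-1 leg `LatticeRotWard G r a` is the Ward leg
on the class `univ`, so for states given with their defining odd-torus sequences the closed item's conclusion follows
from §4. [folklore] -/
theorem latticeRotWardOn_univ_of_latticeRotWard (r : LatticeRep G) (a : ℝ → ℝ)
    (h : Summit.QuantumFields.YangMills.Cruxes.OSLegsAtWeakCouplingC.Y2Bridge.LatticeRotWard G r a) :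
    LatticeRotWardOn G r a Set.univ :=
  fun sch _ ha hβ hr => h sch ha hβ hr

end Summit.QuantumFields.YangMills.Theorems.InfiniteVolume.E1

end
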